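import Mathlib
import HarnessLib
import Summits.Ventures.LatticeQCDFlow.Scaling.MixedPowerCostExponent

/-!
# The step-size tuning law of an order-`p` integrator in the `Var(ΔH) = C·V·ε^{2p}` model: the matched step, the frozen step count `n₀ = ⌈τ(CV/v)^{1/(2p)}⌉`, and the VOLUME LAW — steps per trajectory grow like `V^{1/(2p)}`, cost per trajectory like `V^{1+1/(2p)}`

HONEST FRAMING: exact (Metropolis-corrected) sampling algorithms for lattice gauge theory;
figures of merit are autocorrelation/cost numbers at stated couplings and volumes; no
continuum-physics claim.

Venture `LatticeQCDFlow` (cell pub-lqcd), topic `Scaling`, FANOUT row 21 (`su3-base`, arm E2 = PBC-HMC).  The row's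
TUNING RULE (HOME/su3-base/CARD-su3-base.md §2, pre-registered; LEVERS `comparator.tuning`): at each point the step
count `n₀` of the OMF4 trajectory (`τ = 2`, `ε = τ/n₀`) is scanned upward "starting from the MEASURED ε⁸-law value
(`Var(ΔH) = C·V·ε⁸`, … ⇒ `n₀(90 %)` … at `16⁴ / 22⁴ / 30⁴`)", frozen at the smallest value whose measured acceptance is
`≥ 0.90`, and written into the config hash.  This file types what the MODEL `Var(ΔH) = C·V·ε^{2p}` (an order-`p`
reversible integrator: leading error `ε^p` per unit time in `ΔH`, extensive in the volume) says about that rule, so the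
row's volume extrapolation of `n₀` has its hypothesis visible — OUR WORK, elementary real analysis over Mathlib and the
tree's `Scaling.secantExponent` / `secantExponent_pure` (row 19, `MixedPowerCostExponent.lean`); no definition is
introduced; nothing is cited as a fact; no number of ours (the acceptance ↔ variance link itself is the Gaussian model of
rows 2/11, `Scoring/GaussianEnergyViolationModel`, and the model-free bound of `Exactness/AcceptanceFromMeanEnergyViolation`,
NOT restated here: this file only needs "acceptance is a decreasing function of the variance", i.e. a variance TARGET `v`).

Symbols: `C > 0` the law's constant, `V > 0` the number of sites, `p ≥ 1` the order, `τ > 0` the trajectory length,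
`v > 0` the variance target; the MATCHED STEP `ε⋆(V) = (v/(CV))^{1/(2p)}` and the MATCHED STEP COUNT
`n⋆(V) = τ/ε⋆(V) = τ·(CV/v)^{1/(2p)}`.

* §1 `modelVar_strictMonoOn` (the model variance is strictly increasing in `ε > 0`), **`modelVar_matchedStep`**
  (`C·V·ε⋆^{2p} = v`), **`modelVar_le_iff_le_matchedStep`** (`C·V·ε^{2p} ≤ v ↔ ε ≤ ε⋆`), `modelVar_half`
  (`Var(ε/2) = Var(ε)/2^{2p}` — a factor `256` per halving at `p = 4`).
* §2 THE FROZEN STEP COUNT: **`modelVar_traj_le_iff`** — for `n ≥ 1` steps of length `τ/n`: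
  `C·V·(τ/n)^{2p} ≤ v ↔ n⋆(V) ≤ n`; hence **`modelVar_traj_le_iff_ceil_le`** — the set of admissible step counts is
  `{n | ⌈n⋆(V)⌉₊ ≤ n}`: in the model the rule's frozen value IS `n₀ = ⌈τ(CV/v)^{1/(2p)}⌉₊` (the scan "upward from the
  law's value" starts at the answer when the law holds, and corrects it when it does not).
* §3 THE VOLUME LAW: `matchedCount_eq_mul_rpow` (`n⋆(V) = τ(C/v)^{1/(2p)} · V^{1/(2p)}` — a pure power of `V`),
  **`matchedCount_ratio`** (`n⋆(V₂)/n⋆(V₁) = (V₂/V₁)^{1/(2p)}`: `C`, `v`, `τ` CANCEL — the extrapolation of `n₀` across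
  volumes does not need the constant), **`secantExponent_matchedCount`** (the two-volume exponent of `n⋆` is EXACTLY
  `1/(2p)`), **`secantExponent_matchedCost`** (force evaluations per trajectory `× V`, i.e. `k·n⋆(V)·V` for `k` stages
  per step: exponent EXACTLY `1 + 1/(2p)`); instances `volumeExponent_leapfrog` (`p = 2`: `1/4` and `5/4`) and
  `volumeExponent_fourthOrder` (`p = 4`: `1/8` and `9/8`).
* §4 the row's three volumes in arithmetic only (`p = 4`, `V = L⁴` so `(V₂/V₁)^{1/8} = (L₂/L₁)^{1/2}`):
  `rpow_volume_ratio_eighth` and the brackets `1.17 < √(22/16) < 1.18`, `1.36 < √(30/16) < 1.37`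
  (`sqrt_ratio_22_16_mem`, `sqrt_ratio_30_16_mem`) — the factors by which the model scales `n⋆` from `16⁴` to `22⁴` and
  `30⁴`; the integer `n₀` then follows by the ceiling of §2, per volume.

NOT CLAIMED: that `Var(ΔH)` of the row's OMF4 on the Wilson action FOLLOWS `C·V·ε⁸` (it is the row's measured law
with its own range of validity — the instability edge `ε ≈ 0.5` of CARD §2 is outside any power law); any value of `C`,
`v`, `n₀`; the acceptance model; cost in seconds.
-/

namespace Summit.Ventures.LatticeQCDFlow.Scaling

open Real

/-! ## §1 The model variance and the matched step -/

/-- The model variance `ε ↦ C·V·ε^{2p}` is strictly increasing on `ε > 0` (`C, V > 0`, `p ≥ 1`). -/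
theorem modelVar_strictMonoOn {C V : ℝ} {p : ℕ} (hC : 0 < C) (hV : 0 < V) (hp : 1 ≤ p) :
    StrictMonoOn (fun ε : ℝ => C * V * ε ^ (2 * p)) (Set.Ioi 0) := by
  intro x hx y _ hxy
  have h2p : 2 * p ≠ 0 := by omega
  have : x ^ (2 * p) < y ^ (2 * p) := pow_lt_pow_left₀ hxy (le_of_lt hx) h2p
  exact mul_lt_mul_of_pos_left this (mul_pos hC hV)

/-- The matched step is positive. -/
theorem matchedStep_pos {C V v : ℝ} {p : ℕ} (hC : 0 < C) (hV : 0 < V) (hv : 0 < v) :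
    0 < (v / (C * V)) ^ (1 / (2 * p : ℝ)) :=
  Real.rpow_pos_of_pos (div_pos hv (mul_pos hC hV)) _

/-- **The matched step solves the model exactly: `C·V·ε⋆^{2p} = v`**, `ε⋆ = (v/(CV))^{1/(2p)}`. -/
theorem modelVar_matchedStep {C V v : ℝ} {p : ℕ} (hC : 0 < C) (hV : 0 < V) (hv : 0 < v) (hp : 1 ≤ p) :
    C * V * ((v / (C * V)) ^ (1 / (2 * p : ℝ))) ^ (2 * p) = v := by
  have hCV : 0 < C * V := mul_pos hC hV
  have hq : 0 ≤ v / (C * V) := (div_pos hv hCV).le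
  have h2p : (2 * p : ℕ) ≠ 0 := by omega
  have e : (1 / (2 * p : ℝ)) = ((2 * p : ℕ) : ℝ)⁻¹ := by push_cast; rw [one_div]
  rw [e, Real.rpow_inv_natCast_pow hq h2p]
  field_simp

/-- **`C·V·ε^{2p} ≤ v ↔ ε ≤ ε⋆`** for `ε > 0`: meeting the variance target is the same as not exceeding the matched
step. -/
theorem modelVar_le_iff_le_matchedStep {C V v ε : ℝ} {p : ℕ} (hC : 0 < C) (hV : 0 < V) (hv : 0 < v) (hp : 1 ≤ p)
    (hε : 0 < ε) :
    C * V * ε ^ (2 * p) ≤ v ↔ ε ≤ (v / (C * V)) ^ (1 / (2 * p : ℝ)) := by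
  have hstar := matchedStep_pos (p := p) hC hV hv
  have hmono := modelVar_strictMonoOn (p := p) hC hV hp
  have hfix := modelVar_matchedStep (p := p) hC hV hv hp
  constructor
  · intro h
    exact (hmono.le_iff_le hε hstar).1 (h.trans hfix.symm.le)
  · intro h
    exact ((hmono.le_iff_le hε hstar).2 h).trans hfix.le

/-- `Var(ε/2) = Var(ε)/2^{2p}`: each halving of the step divides the model variance by `2^{2p}` (`256` at `p = 4`). -/
theorem modelVar_half (C V ε : ℝ) (p : ℕ) : C * V * (ε / 2) ^ (2 * p) = C * V * ε ^ (2 * p) / 2 ^ (2 * p) := by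
  rw [div_pow]; ring

/-- At `p = 4` the halving factor is `256`. -/
theorem two_pow_two_mul_four : (2 : ℝ) ^ (2 * 4) = 256 := by norm_num

/-! ## §2 The frozen step count -/

/-- The matched step count is positive. -/
theorem matchedCount_pos {C V v τ : ℝ} {p : ℕ} (hC : 0 < C) (hV : 0 < V) (hv : 0 < v) (hτ : 0 < τ) :
    0 < τ * (C * V / v) ^ (1 / (2 * p : ℝ)) :=
  mul_pos hτ (Real.rpow_pos_of_pos (div_pos (mul_pos hC hV) hv) _)

/-- `τ/ε⋆ = τ·(CV/v)^{1/(2p)}`: the two writings of the matched step count agree. -/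
theorem div_matchedStep_eq_matchedCount {C V v τ : ℝ} {p : ℕ} (hC : 0 < C) (hV : 0 < V) (hv : 0 < v) :
    τ / (v / (C * V)) ^ (1 / (2 * p : ℝ)) = τ * (C * V / v) ^ (1 / (2 * p : ℝ)) := by
  have hCV : 0 < C * V := mul_pos hC hV
  rw [div_eq_mul_inv, ← Real.rpow_neg (div_pos hv hCV).le, ← inv_div, Real.inv_rpow (div_pos hCV hv).le,
    Real.rpow_neg (div_pos hCV hv).le, inv_inv]

/-- **THE STEP-COUNT FORM OF THE TARGET: `C·V·(τ/n)^{2p} ≤ v ↔ n⋆(V) ≤ n`** for a trajectory of `n ≥ 1` steps of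
length `τ/n` (`n⋆(V) = τ·(CV/v)^{1/(2p)}`). -/
theorem modelVar_traj_le_iff {C V v τ : ℝ} {p n : ℕ} (hC : 0 < C) (hV : 0 < V) (hv : 0 < v) (hp : 1 ≤ p) (hτ : 0 < τ)
    (hn : 1 ≤ n) :
    C * V * (τ / n) ^ (2 * p) ≤ v ↔ τ * (C * V / v) ^ (1 / (2 * p : ℝ)) ≤ n := by
  have hn0 : (0 : ℝ) < n := Nat.cast_pos.2 (by omega)
  have hstar := matchedStep_pos (p := p) hC hV hv
  rw [modelVar_le_iff_le_matchedStep (p := p) hC hV hv hp (div_pos hτ hn0), div_le_iff₀ hn0,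
    ← div_le_iff₀' hstar, div_matchedStep_eq_matchedCount hC hV hv]

/-- **THE FROZEN VALUE IS THE CEILING: `C·V·(τ/n)^{2p} ≤ v ↔ ⌈n⋆(V)⌉₊ ≤ n`** (`n ≥ 1`) — in the model the admissible
step counts are exactly the integers from `n₀ = ⌈τ(CV/v)^{1/(2p)}⌉₊` on, so the rule's "smallest admissible `n`" is that
ceiling. -/
theorem modelVar_traj_le_iff_ceil_le {C V v τ : ℝ} {p n : ℕ} (hC : 0 < C) (hV : 0 < V) (hv : 0 < v) (hp : 1 ≤ p)
    (hτ : 0 < τ) (hn : 1 ≤ n) :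
    C * V * (τ / n) ^ (2 * p) ≤ v ↔ ⌈τ * (C * V / v) ^ (1 / (2 * p : ℝ))⌉₊ ≤ n := by
  rw [modelVar_traj_le_iff hC hV hv hp hτ hn, Nat.ceil_le]

/-- The ceiling itself is admissible and positive: `1 ≤ n₀` and the target is met at `n₀` (so the admissible set is
non-empty and `n₀` is its least element). -/
theorem modelVar_traj_ceil {C V v τ : ℝ} {p : ℕ} (hC : 0 < C) (hV : 0 < V) (hv : 0 < v) (hp : 1 ≤ p) (hτ : 0 < τ) :
    1 ≤ ⌈τ * (C * V / v) ^ (1 / (2 * p : ℝ))⌉₊ ∧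
      C * V * (τ / (⌈τ * (C * V / v) ^ (1 / (2 * p : ℝ))⌉₊ : ℕ)) ^ (2 * p) ≤ v := by
  have h1 : 1 ≤ ⌈τ * (C * V / v) ^ (1 / (2 * p : ℝ))⌉₊ :=
    Nat.one_le_iff_ne_zero.2 (Nat.pos_iff_ne_zero.1 (Nat.ceil_pos.2 (matchedCount_pos hC hV hv hτ)))
  exact ⟨h1, (modelVar_traj_le_iff_ceil_le hC hV hv hp hτ h1).2 le_rfl⟩

/-! ## §3 The volume law -/

/-- `n⋆(V) = (τ·(C/v)^{1/(2p)}) · V^{1/(2p)}` — the matched step count is a PURE POWER of the volume. -/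
theorem matchedCount_eq_mul_rpow {C V v τ : ℝ} {p : ℕ} (hC : 0 < C) (hV : 0 < V) (hv : 0 < v) :
    τ * (C * V / v) ^ (1 / (2 * p : ℝ)) = τ * (C / v) ^ (1 / (2 * p : ℝ)) * V ^ (1 / (2 * p : ℝ)) := by
  have e : C * V / v = C / v * V := by field_simp
  rw [e, Real.mul_rpow (div_pos hC hv).le hV.le, mul_assoc]

/-- **`n⋆(V₂)/n⋆(V₁) = (V₂/V₁)^{1/(2p)}`** — the constant `C`, the target `v` and the trajectory length cancel: scaling
the frozen step count from one volume to another needs ONLY the order of the integrator. -/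
theorem matchedCount_ratio {C V₁ V₂ v τ : ℝ} {p : ℕ} (hC : 0 < C) (hV₁ : 0 < V₁) (hV₂ : 0 < V₂) (hv : 0 < v)
    (hτ : 0 < τ) :
    (τ * (C * V₂ / v) ^ (1 / (2 * p : ℝ))) / (τ * (C * V₁ / v) ^ (1 / (2 * p : ℝ))) = (V₂ / V₁) ^ (1 / (2 * p : ℝ)) := by
  rw [matchedCount_eq_mul_rpow hC hV₁ hv, matchedCount_eq_mul_rpow hC hV₂ hv,
    Real.div_rpow hV₂.le hV₁.le]
  have hk : 0 < τ * (C / v) ^ (1 / (2 * p : ℝ)) := mul_pos hτ (Real.rpow_pos_of_pos (div_pos hC hv) _)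
  have h1 : 0 < V₁ ^ (1 / (2 * p : ℝ)) := Real.rpow_pos_of_pos hV₁ _
  field_simp

/-- **THE VOLUME EXPONENT OF THE STEP COUNT IS EXACTLY `1/(2p)`**: the two-volume secant exponent (the tree's
`Scaling.secantExponent`) of `V ↦ n⋆(V)` between any `0 < V₁ < V₂`. -/
theorem secantExponent_matchedCount {C v τ V₁ V₂ : ℝ} {p : ℕ} (hC : 0 < C) (hv : 0 < v) (hτ : 0 < τ) (hV₁ : 0 < V₁)
    (hV : V₁ < V₂) :
    secantExponent (fun V => τ * (C * V / v) ^ (1 / (2 * p : ℝ))) V₁ V₂ = 1 / (2 * p : ℝ) := by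
  have hV₂ : 0 < V₂ := hV₁.trans hV
  have hk : 0 < τ * (C / v) ^ (1 / (2 * p : ℝ)) := mul_pos hτ (Real.rpow_pos_of_pos (div_pos hC hv) _)
  have e : secantExponent (fun V => τ * (C * V / v) ^ (1 / (2 * p : ℝ))) V₁ V₂ =
      secantExponent (fun V => τ * (C / v) ^ (1 / (2 * p : ℝ)) * V ^ (1 / (2 * p : ℝ))) V₁ V₂ := by
    simp only [secantExponent, matchedCount_eq_mul_rpow (p := p) hC hV₁ hv, matchedCount_eq_mul_rpow (p := p) hC hV₂ hv]
  rw [e, secantExponent_pure hk hV₁ hV]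

/-- **THE VOLUME EXPONENT OF THE COST PER TRAJECTORY IS EXACTLY `1 + 1/(2p)`**: `k` force evaluations per step
(`k > 0` stages), each of cost `∝ V`, i.e. `cost(V) = k·n⋆(V)·V`. -/
theorem secantExponent_matchedCost {C v τ k V₁ V₂ : ℝ} {p : ℕ} (hC : 0 < C) (hv : 0 < v) (hτ : 0 < τ) (hk : 0 < k)
    (hV₁ : 0 < V₁) (hV : V₁ < V₂) :
    secantExponent (fun V => k * (τ * (C * V / v) ^ (1 / (2 * p : ℝ))) * V) V₁ V₂ = 1 + 1 / (2 * p : ℝ) := by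
  have hV₂ : 0 < V₂ := hV₁.trans hV
  have hkk : 0 < k * (τ * (C / v) ^ (1 / (2 * p : ℝ))) :=
    mul_pos hk (mul_pos hτ (Real.rpow_pos_of_pos (div_pos hC hv) _))
  have key : ∀ V, 0 < V → k * (τ * (C * V / v) ^ (1 / (2 * p : ℝ))) * V =
      k * (τ * (C / v) ^ (1 / (2 * p : ℝ))) * V ^ (1 + 1 / (2 * p : ℝ)) := fun V hVp => by
    rw [matchedCount_eq_mul_rpow hC hVp hv, Real.rpow_add hVp, Real.rpow_one]
    ring
  have e : secantExponent (fun V => k * (τ * (C * V / v) ^ (1 / (2 * p : ℝ))) * V) V₁ V₂ =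
      secantExponent (fun V => k * (τ * (C / v) ^ (1 / (2 * p : ℝ))) * V ^ (1 + 1 / (2 * p : ℝ))) V₁ V₂ := by
    simp only [secantExponent, key V₁ hV₁, key V₂ hV₂]
  rw [e, secantExponent_pure hkk hV₁ hV]

/-- Leapfrog (`p = 2`): steps per trajectory `∝ V^{1/4}`, cost per trajectory `∝ V^{5/4}`. -/
theorem volumeExponent_leapfrog : (1 / (2 * (2 : ℕ) : ℝ)) = 1 / 4 ∧ (1 + 1 / (2 * (2 : ℕ) : ℝ)) = 5 / 4 := by
  constructor <;> norm_num

/-- Fourth order (`p = 4`, the row's OMF4): steps per trajectory `∝ V^{1/8}`, cost per trajectory `∝ V^{9/8}`. -/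
theorem volumeExponent_fourthOrder : (1 / (2 * (4 : ℕ) : ℝ)) = 1 / 8 ∧ (1 + 1 / (2 * (4 : ℕ) : ℝ)) = 9 / 8 := by
  constructor <;> norm_num

/-! ## §4 The row's three volumes, arithmetic only (`p = 4`, `V = L⁴`) -/

/-- With `V = L⁴` the fourth-order factor is a square root of the linear size ratio:
`((L₂⁴)/(L₁⁴))^{1/8} = (L₂/L₁)^{1/2}` (`0 < L₁, L₂`). -/
theorem rpow_volume_ratio_eighth {L₁ L₂ : ℝ} (hL₁ : 0 < L₁) (hL₂ : 0 < L₂) :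
    (L₂ ^ 4 / L₁ ^ 4) ^ (1 / (2 * (4 : ℕ) : ℝ)) = Real.sqrt (L₂ / L₁) := by
  have h : L₂ ^ 4 / L₁ ^ 4 = (L₂ / L₁) ^ 4 := by rw [div_pow]
  rw [h, Real.sqrt_eq_rpow, ← Real.rpow_natCast, ← Real.rpow_mul (div_pos hL₂ hL₁).le]
  norm_num

/-- `1.17 < √(22/16) < 1.18` — the model's factor on `n⋆` from `16⁴` to `22⁴` at fourth order. -/
theorem sqrt_ratio_22_16_mem : (1.17 : ℝ) < Real.sqrt (22 / 16) ∧ Real.sqrt (22 / 16) < 1.18 := by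
  constructor
  · rw [show (1.17 : ℝ) = Real.sqrt (1.17 ^ 2) by rw [Real.sqrt_sq (by norm_num)]]
    exact Real.sqrt_lt_sqrt (by norm_num) (by norm_num)
  · rw [show (1.18 : ℝ) = Real.sqrt (1.18 ^ 2) by rw [Real.sqrt_sq (by norm_num)]]
    exact Real.sqrt_lt_sqrt (by norm_num) (by norm_num)

/-- `1.36 < √(30/16) < 1.37` — the model's factor on `n⋆` from `16⁴` to `30⁴` at fourth order. -/
theorem sqrt_ratio_30_16_mem : (1.36 : ℝ) < Real.sqrt (30 / 16) ∧ Real.sqrt (30 / 16) < 1.37 := by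
  constructor
  · rw [show (1.36 : ℝ) = Real.sqrt (1.36 ^ 2) by rw [Real.sqrt_sq (by norm_num)]]
    exact Real.sqrt_lt_sqrt (by norm_num) (by norm_num)
  · rw [show (1.37 : ℝ) = Real.sqrt (1.37 ^ 2) by rw [Real.sqrt_sq (by norm_num)]]
    exact Real.sqrt_lt_sqrt (by norm_num) (by norm_num)

end Summit.Ventures.LatticeQCDFlow.Scaling
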